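import Summits.Schanuel.Schanuel.Theorems.ZilberEacComplexQuadricEscapePowers
import Summits.Schanuel.Schanuel.Theorems.ZilberEacComplexQuadricEscapeLaurent
import HarnessLib

/-!
# EC vocabulary and a model system for the escape theorems with general fibres

* `quadricEscapeLaurent_inter_expGraph_nonempty` — set-builder/`expGraph` form of
  `exists_expPoint_quadricEscape_laurent` (`ZilberEacComplexQuadricEscapeLaurent.lean`);
* `isotropicBase_powerFibre_model_system_solvable` — `∃ z w, e^z = e^{2(z² - w²)} + z, e^w = e^{z²-w²} - w`:
  an exponential point of the 3-fold `{x₃ = x₁² - x₂², y₁ = y₃² + x₁, y₂ = y₃ - x₂}` over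
  Mantova–Masser's ISOTROPIC base (where the escape theorem with `κ = (1,1)` does not apply) via
  `exists_expPoint_quadricEscape_powers` with `κ = (2,1)`, `κᵀMκ = 3`.

First open rung of EAC (`dim π₁ V = n - 1`): Mantova–Masser, PLMS 129 (2024), §1 p. 5.
HONEST FRAMING: modest sub-rungs of EAC; nothing here bears on Schanuel's conjecture.
-/

noncomputable section

open Complex MvPolynomial Metric Set Filter Topology

set_option linter.dupNamespace false

namespace Summit.Schanuel.Schanuel.Theorems

/-- **The constant-top-coefficient escape varieties meet the graph of exponentiation** (EC vocabulary):
with `n = s + 1`, `κⱼ ≥ 1`, `Σᵢⱼ Mᵢⱼκᵢκⱼ ≠ 0`, `cⱼ ≠ 0`, `A_{j,i}` arbitrary, the subvariety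
`V = {xₙ = xᵀMx + b·x + c₀, yⱼ = yₙ^{κⱼ}(cⱼ + Σ_{i<K} A_{j,i}(x') yₙ^{-(i+1)})}` of `ℂⁿ × ℂⁿ` contains a
point of `Literature.NumberTheory.Transcendental.expGraph ℂ n`.
[cite: MantovaMasser2023, §1 p.5 (the open case dim π(V) = 2 in ℂ³×ℂˣ³)] -/
theorem quadricEscapeLaurent_inter_expGraph_nonempty {s K : ℕ} (M : Fin s → Fin s → ℂ) (b : Fin s → ℂ)
    (c₀ : ℂ) (κ : Fin s → ℕ) (hκ : ∀ j, 0 < κ j) (hα : ∑ i, ∑ j, M i j * (κ i : ℂ) * (κ j : ℂ) ≠ 0)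
    (c : Fin s → ℂ) (hc : ∀ j, c j ≠ 0) (A : Fin s → Fin K → MvPolynomial (Fin s) ℂ) :
    ({z : Fin (s + 1) ⊕ Fin (s + 1) → ℂ |
        z (Sum.inl (Fin.last s)) = ∑ i, ∑ l, M i l * z (Sum.inl (Fin.castSucc i)) * z (Sum.inl (Fin.castSucc l)) +
          ∑ i, b i * z (Sum.inl (Fin.castSucc i)) + c₀ ∧
        ∀ j : Fin s, z (Sum.inr (Fin.castSucc j)) = z (Sum.inr (Fin.last s)) ^ (κ j) *
          (c j + ∑ i : Fin K, eval (fun l => z (Sum.inl (Fin.castSucc l))) (A j i) *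
            (z (Sum.inr (Fin.last s)) ^ ((i : ℕ) + 1))⁻¹)} ∩
      Literature.NumberTheory.Transcendental.expGraph ℂ (s + 1)).Nonempty := by
  obtain ⟨x, hx⟩ := exists_expPoint_quadricEscape_laurent M b c₀ κ hκ hα c hc A
  set X : Fin (s + 1) → ℂ := Fin.snoc x (∑ i, ∑ l, M i l * x i * x l + ∑ i, b i * x i + c₀) with hX
  refine ⟨Sum.elim X fun i => exp (X i), ⟨?_, fun j => ?_⟩, fun i => ?_⟩
  · simp only [Sum.elim_inl, hX, Fin.snoc_last, Fin.snoc_castSucc]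
  · simp only [Sum.elim_inl, Sum.elim_inr, hX, Fin.snoc_castSucc, Fin.snoc_last]
    exact hx j
  · simp [Literature.ModelTheory.ExponentialFields.ExponentialRing.complex_exp_eq]

/-- **A model system over Mantova–Masser's isotropic base is solvable**: there are `z, w ∈ ℂ` with
`e^z = e^{2(z² - w²)} + z` and `e^w = e^{z² - w²} - w` — an exponential point of the 3-fold
`V = {x₃ = x₁² - x₂², y₁ = y₃² + x₁, y₂ = y₃ - x₂} ⊆ ℂ³ × (ℂˣ)³`. The base `x₃ = x₁² - x₂²` is
isotropic in the diagonal direction (`Σᵢⱼ Mᵢⱼ = 0`, so `exists_expPoint_quadricEscape_matrix` does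
not apply to fibres `cⱼy₃ + Aⱼ`), but the fibre exponents `κ = (2,1)` give `κᵀMκ = 4 - 1 = 3 ≠ 0`.
(For the fibres `y₁ = z - y₃, y₂ = -w - y₃` of Mantova–Masser's own display the lattice-ray Theorem A
applies instead.) New. [cite: MantovaMasser2023, §1 p.5 (the open case dim π(V) = 2 in ℂ³×ℂˣ³)] -/
theorem isotropicBase_powerFibre_model_system_solvable :
    ∃ z w : ℂ, exp z = exp (2 * (z ^ 2 - w ^ 2)) + z ∧ exp w = exp (z ^ 2 - w ^ 2) - w := by
  set M : Fin 2 → Fin 2 → ℂ := ![![1, 0], ![0, -1]] with hM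
  set κ : Fin 2 → ℕ := ![2, 1] with hκdef
  set A : Fin 2 → MvPolynomial (Fin 2) ℂ := ![X 0, -X 1] with hAdef
  have hκ : ∀ j, 0 < κ j := Fin.forall_fin_two.mpr ⟨by simp [hκdef], by simp [hκdef]⟩
  have hα : ∑ i, ∑ j, M i j * (κ i : ℂ) * (κ j : ℂ) ≠ 0 := by
    simp [Fin.sum_univ_two, hM, hκdef]
    norm_num
  obtain ⟨x, hx⟩ := exists_expPoint_quadricEscape_powers M (fun _ => 0) 0 κ hκ hα (fun _ => 1)
    (fun _ => one_ne_zero) A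
  have hg : (∑ i, ∑ l, M i l * x i * x l + ∑ i, (fun _ : Fin 2 => (0 : ℂ)) i * x i + 0) =
      x 0 ^ 2 - x 1 ^ 2 := by
    simp [Fin.sum_univ_two, hM]
    ring
  refine ⟨x 0, x 1, ?_, ?_⟩
  · have h0 := hx 0
    rw [hg] at h0
    simp only [hκdef, hAdef, Matrix.cons_val_zero, one_mul, eval_X] at h0
    rw [h0, ← Complex.exp_nat_mul]
    push_cast
    ring_nf
  · have h1 := hx 1
    rw [hg] at h1
    simp only [hκdef, hAdef, Matrix.cons_val_one, Matrix.cons_val_zero, one_mul, pow_one, map_neg,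
      eval_X] at h1
    rw [h1]
    ring

end Summit.Schanuel.Schanuel.Theorems
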